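import Summits.QuantumFields.YangMills.Theorems.UnitScaleTiltProp8FlatPortKernelRowsL0
import HarnessLib

/-!
# Route `UnitScaleTilt`, crux K1 child «MinimiserStabilityRegPr» (stmt-QuantumFields-19200), stub H `stub_halvingStep`, the (165)-A₁ row's dressing letter `C_E`:
# **THE SHARP `∂^{η*}∂^η` KERNEL ROW (k3♯) OF THE CANONICAL `flatH` AT THE PORT DISTANCE — `w₂(b)·|(∂^{η*}∂^η flatH e_c)(b)| ≤ C₃·e^{−r(d_T+3)}` (ONE POWER OF
# `w₁(b) = L^{j(b)}η` SHARPER THAN (k3) OF `HKernelRows`) — AND (X1♯): THE `∂^{η*}∂^η`-SUP ROW AT LEVEL-WEIGHTED DATA `(L^{j(c)}η)|X(c)| ≤ t` FROM (k3♯) + (162)**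
# = WANTED №g26-1 (X1) RE-OPENED under the ♭ chart for print's `H = Hs` (RULING g26-№11; ★w3-19200 g4 LOCATED 07:21:35Z; ★w5-19200 g3 04:38:23Z)

Cell `ym3-torus` (HUMAN RULING D-0037, YM ladder rung R3), width seat `ym-ust-19936-w3` gen 4.  `--supports stmt-QuantumFields-19200 --as helper`; count-neutral; def-free.
Serves item 19936 `HistoryTailL` only through (T).

WHY.  For the chart-`H` of record `Hs X = HM((L^{j}η)⁻¹•X)` (print's (45) «`LʲηQ_jHB = B`») at UNWEIGHTED block data, the dressing letter (X1) is the `flatH` row at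
LEVEL-weighted data; P2's rows of record give only `FlatHCurlCurlSupRow.curlCurlRowW1_of_kernelRows` (one power of `w₁` short), because (k3) of `HKernelRows` —
`w₃(b)·|(∂*∂ flatH e_c)(b)| ≤ C·e^{−δd}` — is LOOSE by `w₁(b)`: its supplier `FlatPortHRows34L0.hRow3_of_portShapes` proves term A ((137) ∘ [Balaban1984PropagatorsII]
Prop. 2.7 (2.149) through `comp_entry_le`) as `|Q*(QGQ*)⁻¹e_c(b)| ≤ (L^{j(b)}η)⁻²·K₃·e^{−rd_T}` and then spends `w₃/(L^{j(b)}η)² = L^{j(b)}η ≤ 1`, and bounds the local term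
B `Q*a e_c` by `b₁·(L^{j(c)}η) ≤ b₁`.  Keeping the factor gives (k3♯) with the SAME constant; summed against level-weighted data the spare `w₁(b)` is exactly the left weight
of the (162) row sum `RowSum162` — print's (88) ∘ [5] (3.132) in the tree's currency.

WHAT IS PROVED (sorry-free; axioms standard; no definition).
* §1 ★ **`hRow3_sharp_of_portShapes`** — same hypotheses as `hRow3_of_portShapes`, conclusion with `w 2 b` in place of `w 3 b`:
  `w₂(b)·|(∂^{η*}∂^η flatH e_c)(b)| ≤ (K₃e^{3r} + b₁e^{r(ℓ+6)})·e^{−r(d_T(y(b), βc)+3)}`, `r = (1−α′)(δ/2)`;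
* §2 ★ **`curlCurlSupRowLW_of_row3sharp`** (abstract; any `F n K D`, `IsLevWeight w`, `dBI ≥ 0`, plain-function `H`): the `w₂`-kernel row at `(C, δ)` + `RowSum162 … dBI w δ₀ B₃`
  (`δ₀/2 ≤ δ`) ⟹ `∀ X t, 0 ≤ t → (∀ c, (L^{j(c)}·(L⁻¹)^{K−n})·|X c| ≤ t) → ∀ b, w₃(b)·|(∂^{η*}∂^ηHX)(b)| ≤ C·B₃·t`;
* §3 ★★ **`curlCurlSupRowSharp_domT`**, ★★ **`curlCurlSupRowSharp_of_adm22`** — (X1♯) at every charted ∕ `Adm22` datum with constants from `L` alone (package B `prop27_kLevel_pad`,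
  one `lemma21_torus` at `(δ₄/2, 1/16)` for (2.63), `rowSum162_domT` at rate `r`).
HONEST SCOPE: bookkeeping over landed certificates; inherits `L ≥ 5` and the `5L`-big-blocks chart condition; NOT a claim about the mass gap.  YM₃ on the three-torus is rung
R3 of the programme, not the Clay problem.

References: T. Bałaban, CMP **102** (1985) 277–309 [Balaban1985Variational] (45)–(46) p.285, (88) p.291, (137)–(140) pp.298–299, (161)–(163) p.303; CMP **96** (1984) 223–250
[Balaban1984PropagatorsII] Lemma 2.1 (2.59)–(2.63) pp.233–234, Prop. 2.7 (2.149), Cor. 2.8 (2.150)–(2.151) p.249.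
-/

set_option autoImplicit false

noncomputable section

open scoped BigOperators InnerProductSpace

namespace Summit.QuantumFields.YangMills.Theorems.FlatPortHRow3SharpL0

open FlatPortHRows34 (aE_single)


open Literature.MathematicalPhysics.QuantumFieldTheory.Balaban1983to89
open Literature.MathematicalPhysics.QuantumFieldTheory.BalabanImbrieJaffe1984to88.BIJ85AxialPropagator411 (BondSpace)
open B5Eq118OneStroke (iterBlockOf iterBlock mem_iterBlock)
open LatticeFieldCalculus (runSite runBond)
open B6MultiLevelBoxOperator (N0)
open B6MultiLevelTorusOperatorL0 (TDomains)
open B6Geom246MultiLevelBoxL0 (bset blkOf)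
open B6Geom246MultiLevelTorusL0 (geomT bondT)
open B6GlobalChartV1 (PV toBox)
open B6GlobalChartV1L0 (blkV1 domT)
open B6Ineq2142KLevelV1 (iterBlockOf_runSite_mem)
open B6Ineq2142KLevelV1L0 (lvl lvl_le lvl_le_mK β qwt qwt_nonneg qwt_le QsE_single_apply exists_of_qwt_ne_zero lev_ends_bounds geomT_dist_ends_le)
open B6Ineq2133TwoScaleV1 (onFun onFun_apply)
open B6GradLegKLevelV1 (DV)
open B6LapLegKLevelV1 (LapV LapV_apply)
open B6RandomWalk (HasMajorant BlockSupp)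
open B6Lemma21Repaired (Ineq263With)
open B6Prop26KLevelSkeletonV1L0 (pref)
open B6Prop27KLevelV1L0 (lam)
open B6Cor28KLevelV1 (onFun_comp)
open B6Cor28KLevelV1L0 (comp_entry_le)
open B6SectADomainsV1 (Domains)
open B6SectAOperatorsV1 (BondIdx BondIdxSpace QsE aE dcE dcsE aE_apply)
open B6SectAVectorModelV1 (GE EE)
open B6SectA (hOp)
open B6CubeWindowV1 (GlobalBand)
open B11Eq115Space (levOf)
open T3ContinuumYM3Torus (T3Family)
open FlatCubeOpsText (IsLevWeight)
open FlatOpsLettersAssembly (flatH)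
open FlatPortDistanceL0 (levOf_domT blkV1_level)
open FlatPortHRows12 (cf_ne_zero toLp_indicator_eq_single indicator_eq_single)
open FlatPortHRows12L0 (flatH_apply_eq)

open FlatPortHRows34L0 (hasMajorant_one toLp_flatH_eq_hOp curlCurl_flatH_band levWeight_eq pref_blkV1)
open FlatCubeOpsText (RowSum162)
open FlatOpsHRowsFromKernels (levBase_bounds abs_data_le exp_le_rowSummand apply_eq_sum_indicator exists_indicator)
open B6RandomWalk (delta3 delta3_pos)
open B6Ineq261LevelGap (K261 K261_nonneg)
open B6Geom246MultiLevelTorusL0 (lemma21_torus)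
open B6Cor28KLevelV1 (two_le_RMh)
open B6QGQCoerciveKLevelV1 (gam0 gam0_pos)
open FlatPortProp27PadL0 (prop27_kLevel_pad)
open FlatPortKernelRows (theta_budget absorb_budget chart_params)
open FlatPortKernelRowsL0 (globalBand_unitWeights unitWeights_pos)
open FlatPortRowSumL0 (rowSum162_domT)

/-- `1 ≤ 3` (named once; every `domT`/`PV` below carries the same proof term). [folklore] -/
private theorem hd3 : 1 ≤ 2 + 1 := by norm_num

/-! ## §1 The sharp row (k3♯) -/

section Carrier

variable (ℓ : ℕ) (hL : Odd (ℓ + 1) ∧ 1 < ℓ + 1) (m : ℕ) (hm : 1 ≤ m) (n K : ℕ)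
variable {Mh R : ℕ} {P' : Fin (2 + 1) → ℕ}
variable (hN : ∀ μ, N0 ℓ Mh (K - n) P' μ = (PV 2 ℓ m K hd3 hL).sitesPerDir 0) (D : TDomains 2 ℓ Mh (K - n) P' R) (hk : K - n ≤ m + K)

/-- ★ **THE SHARP ROW (k3♯) OF `∂^{η*}∂^η flatH` FROM THE PORT's SHAPES** — `hRow3_of_portShapes` with the left weight `w₂(b)` instead of `w₃(b)` and the SAME constant: term A's
`(L^{j(b)}η)⁻²` prefactor cancels `w₂(b)` exactly (no `≤ 1` spent), term B's local `Q*a` gives `b₁·(L^{j(b)}/L^{j(c)})² ≤ b₁`.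
[cite: Balaban1985Variational, (137)-(140) p.298-299, (161) p.303; Balaban1984PropagatorsII, Prop. 2.7 (2.149), Cor. 2.8 (2.151) p.249] -/
theorem hRow3_sharp_of_portShapes (hRM : 2 ≤ R * Mh) (hMh : 1 ≤ Mh) (hP : ∀ μ, 1 ≤ P' μ)
    {ws : BondIdx (B6GlobalChartV1L0.domT (hd := hd3) hN D hk) → ℝ} (hws : ∀ i, 0 < ws i) {b₀ b₁ : ℝ} (hb₁ : 0 ≤ b₁) (hband : GlobalBand b₀ b₁ ((((ℓ + 1 : ℕ) : ℝ)) ^ (K - n)) ws)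
    {δ₃ Cγ δ c63 α' : ℝ} (hCγ : 0 ≤ Cγ) (hδ : 0 < δ) (hδ3 : δ ≤ δ₃) (hα' : α' ≤ 1)
    (h2149 : ∀ c' c : BondIdx (domT (hd := hd3) hN D hk),
      |⟪EuclideanSpace.single c' (1 : ℝ), EE (domT (hd := hd3) hN D hk) (cf_ne_zero ℓ n K) hws (EuclideanSpace.single c (1 : ℝ))⟫_ℝ| ≤
        (lam hN D hk ((((ℓ + 1 : ℕ) : ℝ)) ^ (K - n)) c')⁻¹ * (lam hN D hk ((((ℓ + 1 : ℕ) : ℝ)) ^ (K - n)) c)⁻¹ *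
          (Cγ * Real.exp (-(δ * (geomT D).dist (β hN D hk c') (β hN D hk c)))))
    (hsmall : ((ℓ : ℝ) + 1) ^ (2 + 3) * Real.exp (-(δ / 2 * ((R : ℝ) * (((ℓ : ℝ) + 1) * Mh) - 1))) ≤ 1)
    (h263 : Ineq263With c63 (geomT D) (δ / 2) α')
    (w : ℕ → PBond (PV 2 ℓ m K hd3 hL) 0 → ℝ) (hw : IsLevWeight (⟨ℓ + 1, hL, m, hm⟩ : T3Family) n K (domT (hd := hd3) hN D hk) w)
    (c : BondIdx (domT (hd := hd3) hN D hk)) (e : BondIdx (domT (hd := hd3) hN D hk) → ℝ) (he : e c = 1) (he' : ∀ c', c' ≠ c → e c' = 0)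
    (b : PBond (PV 2 ℓ m K hd3 hL) 0) :
    w 2 b * |(dcsE ((((ℓ + 1 : ℕ) : ℝ)) ^ (K - n)) (dcE ((((ℓ + 1 : ℕ) : ℝ)) ^ (K - n))
        (WithLp.toLp 2 (flatH (⟨ℓ + 1, hL, m, hm⟩ : T3Family) n K (domT (hd := hd3) hN D hk) e)))) b| ≤
      ((Cγ * (2 * (((ℓ + 1 : ℕ) : ℝ)) ^ (2 + 1) * Real.exp (δ₃ * ((ℓ : ℝ) + 3))) * ((ℓ : ℝ) + 1) ^ 2 * ((ℓ : ℝ) + 1) ^ (2 + 3) * (2 * ((2 : ℝ) + 1)) * c63 ^ 2) *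
          Real.exp (3 * ((1 - α') * (δ / 2))) + b₁ * Real.exp ((1 - α') * (δ / 2) * ((ℓ : ℝ) + 6))) *
        Real.exp (-((1 - α') * (δ / 2) * (((bondT D).dist (blkV1 hN D b) (β hN D hk c) : ℝ) + 3))) := by
  -- notation
  set cf : ℝ := (((ℓ + 1 : ℕ) : ℝ)) ^ (K - n) with hcf
  set r : ℝ := (1 - α') * (δ / 2) with hr
  set K₃ : ℝ := Cγ * (2 * (((ℓ + 1 : ℕ) : ℝ)) ^ (2 + 1) * Real.exp (δ₃ * ((ℓ : ℝ) + 3))) * ((ℓ : ℝ) + 1) ^ 2 * ((ℓ : ℝ) + 1) ^ (2 + 3) * (2 * ((2 : ℝ) + 1)) * c63 ^ 2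
    with hK₃
  set dT : ℝ := ((bondT D).dist (blkV1 hN D b) (β hN D hk c) : ℝ) with hdT
  have hdist : (geomT D).dist (blkV1 hN D b) (β hN D hk c) = dT := rfl
  have hL0 : (0 : ℝ) < ((ℓ + 1 : ℕ) : ℝ) := by exact_mod_cast Nat.succ_pos ℓ
  have hL1 : (1 : ℝ) ≤ ((ℓ + 1 : ℕ) : ℝ) := by exact_mod_cast Nat.succ_le_succ (Nat.zero_le ℓ)
  have hcf0 : 0 < cf := pow_pos hL0 _
  have hr0 : 0 ≤ r := by rw [hr]; exact mul_nonneg (by linarith) (by linarith)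
  have hK₃0 : 0 ≤ K₃ := by rw [hK₃]; positivity
  have hdT0 : 0 ≤ dT := Nat.cast_nonneg _
  set Lj : ℝ := (((ℓ + 1 : ℕ) : ℝ)) ^ D.lev (toBox hN b.src : Fin (2 + 1) → ℤ) with hLj
  have hLj0 : 0 < Lj := pow_pos hL0 _
  have hLjcf : Lj ≤ cf := pow_le_pow_right₀ hL1 (D.lev_le _)
  -- (137) at the band weights, read at `b`
  have hcc := curlCurl_flatH_band ℓ hL m hm n K hN D hk hws e
  rw [toLp_indicator_eq_single he he'] at hcc
  rw [hcc, PiLp.sub_apply]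
  -- term A: `Q*(QGQ*)⁻¹e_c` through the composition step with the identity as left factor
  have hA : |QsE (domT (hd := hd3) hN D hk) (EE (domT (hd := hd3) hN D hk) (cf_ne_zero ℓ n K) hws (EuclideanSpace.single c (1 : ℝ))) b| ≤
      (1 : ℝ) / pref cf (blkV1 hN D b) * K₃ * Real.exp (-(r * dT)) := by
    have h := comp_entry_le hN D hk (cf_ne_zero ℓ n K) hws hRM hMh hP (T := (1 : Module.End ℝ (PBond (PV 2 ℓ m K hd3 hL) 0 → ℝ)))
      (F := fun _ => (1 : ℝ)) (fun _ => zero_le_one) hCγ hδ hδ3 (hasMajorant_one hN D δ₃) h2149 hsmall h263 c b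
    rw [LinearMap.comp_apply, Module.End.one_apply, onFun_apply, LinearMap.comp_apply] at h
    rw [hdist] at h
    exact h
  -- term B: the local `Q*a e_c = a(c)·q_c`
  have hBeq : QsE (domT (hd := hd3) hN D hk) (aE (domT (hd := hd3) hN D hk) ws (EuclideanSpace.single c (1 : ℝ))) b = ws c * qwt hN D hk c b := by
    rw [aE_single, map_smul, PiLp.smul_apply, smul_eq_mul, QsE_single_apply]
  -- the weights
  have hw2 : w 2 b = (Lj / cf) ^ 2 := levWeight_eq ℓ hL m hm n K hN D hk hw 2 b
  have hpref : pref cf (blkV1 hN D b) = (Lj / cf) ^ 2 := pref_blkV1 ℓ hL m n K hN D cf b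
  have hq0 : 0 ≤ Lj / cf := div_nonneg hLj0.le hcf0.le
  have hq1 : Lj / cf ≤ 1 := (div_le_one hcf0).2 hLjcf
  -- bound on term A with the weight: `(Lj/cf)²/(Lj/cf)² = 1` — NO factor is spent (the sharp row)
  have hA' : w 2 b * |QsE (domT (hd := hd3) hN D hk) (EE (domT (hd := hd3) hN D hk) (cf_ne_zero ℓ n K) hws (EuclideanSpace.single c (1 : ℝ))) b| ≤
      K₃ * Real.exp (-(r * dT)) := by
    rw [hw2]
    refine (mul_le_mul_of_nonneg_left hA (pow_nonneg hq0 2)).trans (le_of_eq ?_)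
    rw [hpref]
    have hq0' : 0 < Lj / cf := div_pos hLj0 hcf0
    have hq : (Lj / cf) ^ 2 ≠ 0 := pow_ne_zero _ hq0'.ne'
    calc (Lj / cf) ^ 2 * (1 / (Lj / cf) ^ 2 * K₃ * Real.exp (-(r * dT)))
        = ((Lj / cf) ^ 2 * (1 / (Lj / cf) ^ 2)) * (K₃ * Real.exp (-(r * dT))) := by ring
      _ = K₃ * Real.exp (-(r * dT)) := by rw [mul_one_div_cancel hq, one_mul]
  -- bound on term B with the weight
  have hB' : w 2 b * |ws c * qwt hN D hk c b| ≤ b₁ * Real.exp (r * ((ℓ : ℝ) + 6)) * Real.exp (-(r * (dT + 3))) := by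
    by_cases hq : qwt hN D hk c b = 0
    · rw [hq, mul_zero, abs_zero, mul_zero]; positivity
    · -- support: `b` issues from the double block of `c`
      obtain ⟨x', hx', t', ht', hfb⟩ := exists_of_qwt_ne_zero hN D hk c hq
      rw [mem_iterBlock] at hx'
      have hsrc : b.src = runSite x' c.1.2.dir t' := by rw [← hfb]; rfl
      have hends : iterBlockOf (lvl hN D hk c) b.src = c.1.2.src ∨ iterBlockOf (lvl hN D hk c) b.src = c.1.2.tgt := by
        rw [hsrc]
        rcases iterBlockOf_runSite_mem (lvl_le_mK hN D hk c) x' c.1.2.dir ht'.le with h | h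
        · exact Or.inl (h.trans hx')
        · right; rw [h, hx']; rfl
      have hlev := (lev_ends_bounds hN D hk hRM c hends).2
      have hnear : (geomT D).dist (β hN D hk c) (blkOf D.toDomains (toBox hN b.src)) ≤ (ℓ : ℝ) + 3 := geomT_dist_ends_le hN D hk hRM hMh hP c hends
      have hdTle : dT ≤ (ℓ : ℝ) + 3 := by
        have hsymm : (geomT D).dist (β hN D hk c) (blkOf D.toDomains (toBox hN b.src)) = dT := by
          rw [hdT]; change (((bondT D).dist _ _ : ℕ) : ℝ) = (((bondT D).dist _ _ : ℕ) : ℝ); rw [SimpleGraph.dist_comm]; rfl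
        rw [hsymm] at hnear; exact hnear
      -- sizes: `w♯(c) ≤ b₁(c′/L^j)²(L^j)^{D}`, `q_c ≤ L^{−jD}`, `w₃(b) ≤ (L^j/c′)³`
      set j : ℕ := lvl hN D hk c with hj
      set Ljc : ℝ := (((ℓ + 1 : ℕ) : ℝ)) ^ j with hLjc
      have hLjc0 : 0 < Ljc := pow_pos hL0 _
      have hLjLjc : Lj ≤ Ljc := pow_le_pow_right₀ hL1 hlev
      have hLjccf : Ljc ≤ cf := pow_le_pow_right₀ hL1 (lvl_le hN D hk c)
      have hwc : ws c ≤ b₁ * (Ljc ^ (2 + 1)) * (cf / Ljc) ^ 2 := by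
        have h2 := (hband c).2
        have hpos : 0 < (cf / Ljc) ^ 2 := by positivity
        rw [div_le_iff₀ hpos] at h2
        exact h2
      have hqle : qwt hN D hk c b ≤ ((((ℓ + 1 : ℕ) : ℝ) ^ (2 + 1)) ^ j)⁻¹ := qwt_le hN D hk c b
      have hvol : Ljc ^ (2 + 1) * ((((ℓ + 1 : ℕ) : ℝ) ^ (2 + 1)) ^ j)⁻¹ = 1 := by
        rw [hLjc, ← pow_mul, ← pow_mul, mul_comm j (2 + 1), mul_inv_cancel₀ (pow_ne_zero _ hL0.ne')]
      have hwq : ws c * qwt hN D hk c b ≤ b₁ * (cf / Ljc) ^ 2 := by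
        calc ws c * qwt hN D hk c b ≤ (b₁ * (Ljc ^ (2 + 1)) * (cf / Ljc) ^ 2) * ((((ℓ + 1 : ℕ) : ℝ) ^ (2 + 1)) ^ j)⁻¹ :=
              mul_le_mul hwc hqle (qwt_nonneg hN D hk c b) (by positivity)
          _ = b₁ * (cf / Ljc) ^ 2 * (Ljc ^ (2 + 1) * ((((ℓ + 1 : ℕ) : ℝ) ^ (2 + 1)) ^ j)⁻¹) := by ring
          _ = b₁ * (cf / Ljc) ^ 2 := by rw [hvol, mul_one]
      have hwq0 : 0 ≤ ws c * qwt hN D hk c b := mul_nonneg (hws c).le (qwt_nonneg hN D hk c b)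
      rw [abs_of_nonneg hwq0, hw2]
      have hmain : (Lj / cf) ^ 2 * (ws c * qwt hN D hk c b) ≤ b₁ := by
        have hx : (Lj / cf) ^ 2 * (cf / Ljc) ^ 2 = (Lj / Ljc) ^ 2 := by
          have h1 : Ljc ≠ 0 := hLjc0.ne'
          have h2 : cf ≠ 0 := hcf0.ne'
          field_simp
        have hratio : (Lj / Ljc) ^ 2 ≤ 1 := by
          have h01 : Lj / Ljc ≤ 1 := (div_le_one hLjc0).2 hLjLjc
          have h00 : 0 ≤ Lj / Ljc := div_nonneg hLj0.le hLjc0.le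
          exact pow_le_one₀ h00 h01
        calc (Lj / cf) ^ 2 * (ws c * qwt hN D hk c b) ≤ (Lj / cf) ^ 2 * (b₁ * (cf / Ljc) ^ 2) := mul_le_mul_of_nonneg_left hwq (pow_nonneg hq0 2)
          _ = b₁ * ((Lj / cf) ^ 2 * (cf / Ljc) ^ 2) := by ring
          _ = b₁ * (Lj / Ljc) ^ 2 := by rw [hx]
          _ ≤ b₁ * 1 := mul_le_mul_of_nonneg_left hratio hb₁
          _ = b₁ := mul_one _
      have hexp : (1 : ℝ) ≤ Real.exp (r * ((ℓ : ℝ) + 6)) * Real.exp (-(r * (dT + 3))) := by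
        rw [← Real.exp_add]
        apply Real.one_le_exp
        have e : r * ((ℓ : ℝ) + 6) + -(r * (dT + 3)) = r * (((ℓ : ℝ) + 3) - dT) := by ring
        rw [e]
        exact mul_nonneg hr0 (by linarith)
      calc (Lj / cf) ^ 2 * (ws c * qwt hN D hk c b) ≤ b₁ * 1 := by rw [mul_one]; exact hmain
        _ ≤ b₁ * (Real.exp (r * ((ℓ : ℝ) + 6)) * Real.exp (-(r * (dT + 3)))) := mul_le_mul_of_nonneg_left hexp hb₁
        _ = _ := by ring
  -- assemble
  have hexpA : Real.exp (-(r * dT)) = Real.exp (3 * r) * Real.exp (-(r * (dT + 3))) := by rw [← Real.exp_add]; congr 1; ring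
  rw [hexpA] at hA'
  have hw20 : 0 ≤ w 2 b := by rw [hw2]; positivity
  calc w 2 b * |QsE (domT (hd := hd3) hN D hk) (EE (domT (hd := hd3) hN D hk) (cf_ne_zero ℓ n K) hws (EuclideanSpace.single c (1 : ℝ))) b -
        QsE (domT (hd := hd3) hN D hk) (aE (domT (hd := hd3) hN D hk) ws (EuclideanSpace.single c (1 : ℝ))) b|
      ≤ w 2 b * (|QsE (domT (hd := hd3) hN D hk) (EE (domT (hd := hd3) hN D hk) (cf_ne_zero ℓ n K) hws (EuclideanSpace.single c (1 : ℝ))) b| +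
          |QsE (domT (hd := hd3) hN D hk) (aE (domT (hd := hd3) hN D hk) ws (EuclideanSpace.single c (1 : ℝ))) b|) :=
        mul_le_mul_of_nonneg_left (abs_sub _ _) hw20
    _ = w 2 b * |QsE (domT (hd := hd3) hN D hk) (EE (domT (hd := hd3) hN D hk) (cf_ne_zero ℓ n K) hws (EuclideanSpace.single c (1 : ℝ))) b| +
          w 2 b * |ws c * qwt hN D hk c b| := by rw [mul_add, hBeq]
    _ ≤ K₃ * (Real.exp (3 * r) * Real.exp (-(r * (dT + 3)))) + b₁ * Real.exp (r * ((ℓ : ℝ) + 6)) * Real.exp (-(r * (dT + 3))) := add_le_add hA' hB'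
    _ = (K₃ * Real.exp (3 * r) + b₁ * Real.exp (r * ((ℓ : ℝ) + 6))) * Real.exp (-(r * (dT + 3))) := by ring


end Carrier

end Summit.QuantumFields.YangMills.Theorems.FlatPortHRow3SharpL0

end
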